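/-
Copyright (c) 2026 the pub-hodgecm-mathlib formalisation cell (harness21).  Prover seat hodgecm-mathlib-K2E3-p23 (g6), HCML Track B «K2-LIT» ∕ h413
(`stmt-HodgeConjecture-24833`), line `K2_E3_EllipticInputs`, leaf (nsc-S-A′) `sig_K2E3GL3PrincipalBlockStandardSpan`, road «EXP», case brick C1 of the architect's
`MEMO-SA-architecture.v2.K2E3-p25-g2.md` §3 (architect K2E3-p25 (g2) «=» on CENSUS-C1 v0 11:39:48Z; dealer K2E3-plan (g4) D96).  FILE 1 of C1: the exponent structure.  2026-09-04.
-/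
import Summits.HodgeConjecture.HodgeConjecture.Theorems.K2E3GL3PrincipalSeriesRegular        -- ★ REG (this seat): regularity tools, `perm_theta_cases`; brings ★ H0-a
import Summits.HodgeConjecture.HodgeConjecture.Theorems.K2E3GL3PrincipalSeriesExhaustion      -- ★ EXH (this seat): `exists_finrank_weightSpace_quotientRep_principalSeries_ne_zero`; brings ★ ADD, ★ E4a
import Summits.HodgeConjecture.HodgeConjecture.Theorems.K2E3GL3EmbeddingOfWeight              -- ★ EMB (K2E3-p17 g8): converse `finrank_weightSpace_ne_zero_of_intertwiningMap_ne_zero`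
import Summits.HodgeConjecture.HodgeConjecture.Theorems.K2E3GL3ExponentRules                  -- ★ H0 (K2E3-p25 g2) ED. 2: `finrank_weightSpace_swap₀₁`, `finrank_weightSpace_swap₁₂` BY NAME
import HarnessLib

/-!
# Crux `H413` — leaf (nsc-S-A′), road «EXP», case C1 «ONE LINK, GENERIC THIRD LETTER» (support `{a, aν, ψ}`), file 1: the exponents of a proper non-zero `N ≤ I θ` and of `I θ ⁄ N`

Cell `hodgecm-mathlib`, Track B; THEOREMS ONLY; count-neutral helper (`--supports stmt-HodgeConjecture-24833 --as helper`).  Currency (CONVENTIONS 08:40Z, MEMO v2 §0):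
`LB 3 = Π a : Fin 3, GL {i // id i = a} F`, `tch θ = ∏ a, (θ a) ∘ det ∘ ev_a`, `I θ = parabolicIndGL F id (𝟙.twist (tch θ))`, `mult V η = finrank ℂ ↥(⨅ m, maxGenEigenspace
(normalizedJacquetGL F id V m) (η m))` (inline), `I₂ x y` = ★ G1 spelling.
SETTING (letters kept ABSTRACT — `x y z : Fˣ →* ℂˣ`; C1 instantiates `x = ην½⁻¹ = a`, `y = ην½ = aν`, `z = ψ` in file 2, where ★ STD-EMB's `D η ψ ↪ I θ` supplies `N`): `θ = ![x, y, z]`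
REGULAR (`Function.Injective θ`, open kernels), `z` UNLINKED to both neighbours in ★ H0's shape: `u₁–u₄` = irreducibility of `I₂ y z`, `I₂ z y`, `I₂ x z`, `I₂ z x` (the pair
`(x, y)` carries NO swap hypothesis — in C1 it is the LINK `y = xν`); `h3cell` = ★ E4a's binder VERBATIM; `N ≤ I θ` a subrepresentation with `⊥ ≠ N ≠ ⊤`.
The six weights split into class_A = {A₁ = (x,y,z) = tch θ, A₂ = (x,z,y), A₃ = (z,x,y)} and class_B = {B₁ = (y,x,z), B₂ = (y,z,x), B₃ = (z,y,x)} (adjacent transpositions of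
the UNLINKED pairs connect the members of a class, ★ H0 `finrank_weightSpace_swap₀₁ ∕ _swap₁₂`).
* **`finrank_weightSpace_sub_and_quotient`** — THE EXPONENT STRUCTURE: `mult N Aᵢ = 1`, `mult N Bᵢ = 0`, `mult (I θ ⁄ N) Aᵢ = 0`, `mult (I θ ⁄ N) Bᵢ = 1` (`i = 1,2,3`), twelve
  conjuncts.  Route: `mult (I θ) = 1` at the six weights (★ REG), `mult N A₁ ≠ 0` (★ EMB converse on the inclusion `N ↪ I θ`, non-zero as `N ≠ ⊥`), the H0 swaps on `N`
  and on `I θ ⁄ N` inside each class, ★ ADD `mult I = mult N + mult (I ⁄ N)`, and ★ EXH (a): `I θ ⁄ N ≠ 0` has a weight, which ★ REG (`weight_six_cases`) places among the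
  six and the count forces into class_B.  COROLLARY: `I θ` has length two with a UNIQUE proper non-zero subrepresentation (file 2).
[BernsteinZelevinsky1977, §2.3, Cor. 2.13, Thm. 2.9]; [Zelevinsky1980, §4.2, Thm. 6.1]; [Casselman1995, §6.3].
HONEST LABEL: HC_CM is proved only modulo the 7 printed citations (2 remaining named inputs: hLiu418 = stmt-HodgeConjecture-24832, h413 = stmt-HodgeConjecture-24833) until
rung 0 closes; count-neutral helper, closes no socket; CONDITIONAL on the binder `h3cell` (E4b) only, stated not assumed as a fact.

## References
* [BernsteinZelevinsky1977] I. N. Bernstein, A. V. Zelevinsky, *Induced representations of reductive p-adic groups I*, Ann. Sci. ÉNS 10 (1977), §2.3, Cor. 2.13, Thm. 2.9.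
* [Zelevinsky1980] A. V. Zelevinsky, *Induced representations of reductive p-adic groups II*, Ann. Sci. ÉNS 13 (1980), §4.2, Thm. 6.1.
* [Casselman1995] W. Casselman, *Introduction to the theory of admissible representations of p-adic reductive groups* (draft 1995), §6.3.
-/

set_option autoImplicit false
-- the mandated namespace repeats `HodgeConjecture.HodgeConjecture`, as in every `Theorems/*.lean` of this sub-problem
set_option linter.dupNamespace false

noncomputable section

open Representation Module Function Literature.NumberTheory.Automorphic Literature.NumberTheory.GaloisRepresentations.IsNonarchimedeanLocalField
open Literature.NumberTheory.GaloisRepresentations Literature.NumberTheory.Automorphic.Zelevinsky1980 Literature.RepresentationTheory.FiniteGroups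
open scoped MatrixGroups NNReal
open Summit.HodgeConjecture.HodgeConjecture.Cruxes.H413.K2E3GL3JacquetMultiplicityAdditive
open Summit.HodgeConjecture.HodgeConjecture.Cruxes.H413.K2E3GL3PrincipalSeriesExponents (finrank_weightSpace_principalSeries_three_tch)
open Summit.HodgeConjecture.HodgeConjecture.Cruxes.H413.K2E3GL3PrincipalSeriesExhaustion (exists_finrank_weightSpace_quotientRep_principalSeries_ne_zero)
open Summit.HodgeConjecture.HodgeConjecture.Cruxes.H413.K2E3GL3EmbeddingOfWeight (finrank_weightSpace_ne_zero_of_intertwiningMap_ne_zero)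
open Summit.HodgeConjecture.HodgeConjecture.Cruxes.H413.K2E3GL3StandardModuleEmbedding (isOpen_ker_tch)
open Summit.HodgeConjecture.HodgeConjecture.Cruxes.H413.K2E3GL3PrincipalSeriesRegular
open Summit.HodgeConjecture.HodgeConjecture.Cruxes.H413.K2E3GL3ExponentRules (finrank_weightSpace_swap₀₁ finrank_weightSpace_swap₁₂)

namespace Summit.HodgeConjecture.HodgeConjecture.Cruxes.H413.K2E3GL3OneLinkGeneric

variable {F : Type} [Field F] [ValuativeRel F] [TopologicalSpace F] [IsNonarchimedeanLocalField F] (x y z : Fˣ →* ℂˣ)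

/-! ## §1 The six weights of `I ![x,y,z]`, explicitly -/

/-- **A weight of `I ![x, y, z]` is one of the six explicit reorderings** (★ REG `exists_perm_of_finrank_weightSpace_principalSeries_ne_zero` + `perm_theta_cases`).
[cite: BernsteinZelevinsky1977, Thm. 5.2] [cite: Casselman1995, Thm. 6.3.5] -/
theorem weight_six_cases (hx : IsOpen ((x.ker : Subgroup Fˣ) : Set Fˣ)) (hy : IsOpen ((y.ker : Subgroup Fˣ) : Set Fˣ)) (hz : IsOpen ((z.ker : Subgroup Fˣ) : Set Fˣ))
    (χ : (Π a : Fin 3, GL {i : Fin 3 // (id : Fin 3 → Fin 3) i = a} F) → ℂ)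
    (h : finrank ℂ ↥(⨅ m, Module.End.maxGenEigenspace (normalizedJacquetGL F (id : Fin 3 → Fin 3) (parabolicIndGL F (id : Fin 3 → Fin 3) ((Representation.trivial ℂ (Π a : Fin 3, GL {i : Fin 3 // (id : Fin 3 → Fin 3) i = a} F) ℂ).twist (∏ a : Fin 3, (((![x, y, z] : Fin 3 → (Fˣ →* ℂˣ))) a).comp (Matrix.GeneralLinearGroup.det.comp (Pi.evalMonoidHom (fun a : Fin 3 => GL {i : Fin 3 // (id : Fin 3 → Fin 3) i = a} F) a))))) m) (χ m)) ≠ 0) :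
    χ = (fun m : (Π a : Fin 3, GL {i : Fin 3 // (id : Fin 3 → Fin 3) i = a} F) => (((∏ a : Fin 3, (((![x, y, z] : Fin 3 → (Fˣ →* ℂˣ))) a).comp (Matrix.GeneralLinearGroup.det.comp (Pi.evalMonoidHom (fun a : Fin 3 => GL {i : Fin 3 // (id : Fin 3 → Fin 3) i = a} F) a))) m : ℂˣ) : ℂ)) ∨
    χ = (fun m : (Π a : Fin 3, GL {i : Fin 3 // (id : Fin 3 → Fin 3) i = a} F) => (((∏ a : Fin 3, (((![x, z, y] : Fin 3 → (Fˣ →* ℂˣ))) a).comp (Matrix.GeneralLinearGroup.det.comp (Pi.evalMonoidHom (fun a : Fin 3 => GL {i : Fin 3 // (id : Fin 3 → Fin 3) i = a} F) a))) m : ℂˣ) : ℂ)) ∨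
    χ = (fun m : (Π a : Fin 3, GL {i : Fin 3 // (id : Fin 3 → Fin 3) i = a} F) => (((∏ a : Fin 3, (((![y, x, z] : Fin 3 → (Fˣ →* ℂˣ))) a).comp (Matrix.GeneralLinearGroup.det.comp (Pi.evalMonoidHom (fun a : Fin 3 => GL {i : Fin 3 // (id : Fin 3 → Fin 3) i = a} F) a))) m : ℂˣ) : ℂ)) ∨
    χ = (fun m : (Π a : Fin 3, GL {i : Fin 3 // (id : Fin 3 → Fin 3) i = a} F) => (((∏ a : Fin 3, (((![y, z, x] : Fin 3 → (Fˣ →* ℂˣ))) a).comp (Matrix.GeneralLinearGroup.det.comp (Pi.evalMonoidHom (fun a : Fin 3 => GL {i : Fin 3 // (id : Fin 3 → Fin 3) i = a} F) a))) m : ℂˣ) : ℂ)) ∨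
    χ = (fun m : (Π a : Fin 3, GL {i : Fin 3 // (id : Fin 3 → Fin 3) i = a} F) => (((∏ a : Fin 3, (((![z, x, y] : Fin 3 → (Fˣ →* ℂˣ))) a).comp (Matrix.GeneralLinearGroup.det.comp (Pi.evalMonoidHom (fun a : Fin 3 => GL {i : Fin 3 // (id : Fin 3 → Fin 3) i = a} F) a))) m : ℂˣ) : ℂ)) ∨
    χ = (fun m : (Π a : Fin 3, GL {i : Fin 3 // (id : Fin 3 → Fin 3) i = a} F) => (((∏ a : Fin 3, (((![z, y, x] : Fin 3 → (Fˣ →* ℂˣ))) a).comp (Matrix.GeneralLinearGroup.det.comp (Pi.evalMonoidHom (fun a : Fin 3 => GL {i : Fin 3 // (id : Fin 3 → Fin 3) i = a} F) a))) m : ℂˣ) : ℂ)) := by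
  have hθ : ∀ i, IsOpen ((((![x, y, z] : Fin 3 → (Fˣ →* ℂˣ)) i).ker : Subgroup Fˣ) : Set Fˣ) := fun i => by
    fin_cases i
    · exact hx
    · exact hy
    · exact hz
  obtain ⟨σ, rfl⟩ := exists_perm_of_finrank_weightSpace_principalSeries_ne_zero (![x, y, z] : Fin 3 → (Fˣ →* ℂˣ)) hθ χ h
  rcases perm_theta_cases (![x, y, z] : Fin 3 → (Fˣ →* ℂˣ)) σ with h | h | h | h | h | h <;>
    simp only [Matrix.cons_val_zero, Matrix.cons_val_one, Matrix.cons_val_two, Matrix.head_cons, Matrix.tail_cons] at h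
  · exact Or.inl (by rw [h])
  · exact Or.inr (Or.inl (by rw [h]))
  · exact Or.inr (Or.inr (Or.inl (by rw [h])))
  · exact Or.inr (Or.inr (Or.inr (Or.inl (by rw [h]))))
  · exact Or.inr (Or.inr (Or.inr (Or.inr (Or.inl (by rw [h])))))
  · exact Or.inr (Or.inr (Or.inr (Or.inr (Or.inr (by rw [h])))))

/-! ## §2 The exponent structure of a proper non-zero subrepresentation of `I ![x,y,z]` and of its quotient -/

omit [ValuativeRel F] [TopologicalSpace F] [IsNonarchimedeanLocalField F] in
/-- `r + s = 1`, `r ≠ 0` ⇒ `r = 1`, `s = 0`. [folklore] -/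
theorem nat_eq_of_add_eq_one_left {r s : ℕ} (h : r + s = 1) (hr : r ≠ 0) : r = 1 ∧ s = 0 := by omega

omit [ValuativeRel F] [TopologicalSpace F] [IsNonarchimedeanLocalField F] in
/-- `r + s = 1`, `s ≠ 0` ⇒ `r = 0`, `s = 1`. [folklore] -/
theorem nat_eq_of_add_eq_one_right {r s : ℕ} (h : r + s = 1) (hs : s ≠ 0) : r = 0 ∧ s = 1 := by omega


set_option maxHeartbeats 800000 in  -- six weights × three representations: the `rcases … <;> rw` bookkeeping exceeds the default
/-- **THE EXPONENT STRUCTURE OF `⊥ < N < I θ` AND OF `I θ ⁄ N`** (`θ = ![x,y,z]` regular, `z` unlinked to both neighbours, no swap available for `(x,y)`): with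
class_A = {(x,y,z), (x,z,y), (z,x,y)} and class_B = {(y,x,z), (y,z,x), (z,y,x)}: `mult N = 1` on class_A and `0` on class_B; `mult (I θ ⁄ N) = 0` on class_A and `1` on class_B.
[cite: BernsteinZelevinsky1977, §2.3, Cor. 2.13, Thm. 2.9] [cite: Zelevinsky1980, §4.2, Thm. 6.1] [cite: Casselman1995, §6.3] -/
theorem finrank_weightSpace_sub_and_quotient (hx : IsOpen ((x.ker : Subgroup Fˣ) : Set Fˣ)) (hy : IsOpen ((y.ker : Subgroup Fˣ) : Set Fˣ))
    (hz : IsOpen ((z.ker : Subgroup Fˣ) : Set Fˣ)) (hinj : Function.Injective (![x, y, z] : Fin 3 → (Fˣ →* ℂˣ)))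
    (u₁ : (parabolicIndGL F (lastBlockLabel 2) ((Representation.trivial ℂ (Π a : Bool, GL {i : Fin 2 // lastBlockLabel 2 i = a} F) ℂ).twist (maxParabolicLeviChar F 2 (y) (z)))).IsIrreducible)
    (u₂ : (parabolicIndGL F (lastBlockLabel 2) ((Representation.trivial ℂ (Π a : Bool, GL {i : Fin 2 // lastBlockLabel 2 i = a} F) ℂ).twist (maxParabolicLeviChar F 2 (z) (y)))).IsIrreducible)
    (u₃ : (parabolicIndGL F (lastBlockLabel 2) ((Representation.trivial ℂ (Π a : Bool, GL {i : Fin 2 // lastBlockLabel 2 i = a} F) ℂ).twist (maxParabolicLeviChar F 2 (x) (z)))).IsIrreducible)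
    (u₄ : (parabolicIndGL F (lastBlockLabel 2) ((Representation.trivial ℂ (Π a : Bool, GL {i : Fin 2 // lastBlockLabel 2 i = a} F) ℂ).twist (maxParabolicLeviChar F 2 (z) (x)))).IsIrreducible)
    (h3cell : ∀ c : Fin 3 → Fin 2, Monotone c → Function.Surjective c →
      ∀ (W : Type) [AddCommGroup W] [Module ℂ W] (σ : Representation ℂ (Π a : Fin 2, GL {i : Fin 3 // c i = a} F) W),
        σ.IsIrreducible → σ.IsSmooth → σ.IsSupercuspidal →
        ∀ (N : Subrepresentation (jacquetGL F c (parabolicIndGL F (id : Fin 3 → Fin 3) ((Representation.trivial ℂ (Π a : Fin 3, GL {i : Fin 3 // (id : Fin 3 → Fin 3) i = a} F) ℂ).twist (∏ a : Fin 3, (((![x, y, z] : Fin 3 → (Fˣ →* ℂˣ))) a).comp (Matrix.GeneralLinearGroup.det.comp (Pi.evalMonoidHom (fun a : Fin 3 => GL {i : Fin 3 // (id : Fin 3 → Fin 3) i = a} F) a)))))))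
          (q : N.toRepresentation.IntertwiningMap σ), q = 0)
    (N : Subrepresentation (parabolicIndGL F (id : Fin 3 → Fin 3) ((Representation.trivial ℂ (Π a : Fin 3, GL {i : Fin 3 // (id : Fin 3 → Fin 3) i = a} F) ℂ).twist (∏ a : Fin 3, (((![x, y, z] : Fin 3 → (Fˣ →* ℂˣ))) a).comp (Matrix.GeneralLinearGroup.det.comp (Pi.evalMonoidHom (fun a : Fin 3 => GL {i : Fin 3 // (id : Fin 3 → Fin 3) i = a} F) a))))))
    (hN0 : N ≠ ⊥) (hN1 : N ≠ ⊤) :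
    finrank ℂ ↥(⨅ m, Module.End.maxGenEigenspace (normalizedJacquetGL F (id : Fin 3 → Fin 3) N.toRepresentation m) (((∏ a : Fin 3, (((![x, y, z] : Fin 3 → (Fˣ →* ℂˣ))) a).comp (Matrix.GeneralLinearGroup.det.comp (Pi.evalMonoidHom (fun a : Fin 3 => GL {i : Fin 3 // (id : Fin 3 → Fin 3) i = a} F) a))) m : ℂˣ) : ℂ)) = 1 ∧
    finrank ℂ ↥(⨅ m, Module.End.maxGenEigenspace (normalizedJacquetGL F (id : Fin 3 → Fin 3) N.toRepresentation m) (((∏ a : Fin 3, (((![x, z, y] : Fin 3 → (Fˣ →* ℂˣ))) a).comp (Matrix.GeneralLinearGroup.det.comp (Pi.evalMonoidHom (fun a : Fin 3 => GL {i : Fin 3 // (id : Fin 3 → Fin 3) i = a} F) a))) m : ℂˣ) : ℂ)) = 1 ∧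
    finrank ℂ ↥(⨅ m, Module.End.maxGenEigenspace (normalizedJacquetGL F (id : Fin 3 → Fin 3) N.toRepresentation m) (((∏ a : Fin 3, (((![z, x, y] : Fin 3 → (Fˣ →* ℂˣ))) a).comp (Matrix.GeneralLinearGroup.det.comp (Pi.evalMonoidHom (fun a : Fin 3 => GL {i : Fin 3 // (id : Fin 3 → Fin 3) i = a} F) a))) m : ℂˣ) : ℂ)) = 1 ∧
    finrank ℂ ↥(⨅ m, Module.End.maxGenEigenspace (normalizedJacquetGL F (id : Fin 3 → Fin 3) N.toRepresentation m) (((∏ a : Fin 3, (((![y, x, z] : Fin 3 → (Fˣ →* ℂˣ))) a).comp (Matrix.GeneralLinearGroup.det.comp (Pi.evalMonoidHom (fun a : Fin 3 => GL {i : Fin 3 // (id : Fin 3 → Fin 3) i = a} F) a))) m : ℂˣ) : ℂ)) = 0 ∧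
    finrank ℂ ↥(⨅ m, Module.End.maxGenEigenspace (normalizedJacquetGL F (id : Fin 3 → Fin 3) N.toRepresentation m) (((∏ a : Fin 3, (((![y, z, x] : Fin 3 → (Fˣ →* ℂˣ))) a).comp (Matrix.GeneralLinearGroup.det.comp (Pi.evalMonoidHom (fun a : Fin 3 => GL {i : Fin 3 // (id : Fin 3 → Fin 3) i = a} F) a))) m : ℂˣ) : ℂ)) = 0 ∧
    finrank ℂ ↥(⨅ m, Module.End.maxGenEigenspace (normalizedJacquetGL F (id : Fin 3 → Fin 3) N.toRepresentation m) (((∏ a : Fin 3, (((![z, y, x] : Fin 3 → (Fˣ →* ℂˣ))) a).comp (Matrix.GeneralLinearGroup.det.comp (Pi.evalMonoidHom (fun a : Fin 3 => GL {i : Fin 3 // (id : Fin 3 → Fin 3) i = a} F) a))) m : ℂˣ) : ℂ)) = 0 ∧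
    finrank ℂ ↥(⨅ m, Module.End.maxGenEigenspace (normalizedJacquetGL F (id : Fin 3 → Fin 3) N.quotientRep m) (((∏ a : Fin 3, (((![x, y, z] : Fin 3 → (Fˣ →* ℂˣ))) a).comp (Matrix.GeneralLinearGroup.det.comp (Pi.evalMonoidHom (fun a : Fin 3 => GL {i : Fin 3 // (id : Fin 3 → Fin 3) i = a} F) a))) m : ℂˣ) : ℂ)) = 0 ∧
    finrank ℂ ↥(⨅ m, Module.End.maxGenEigenspace (normalizedJacquetGL F (id : Fin 3 → Fin 3) N.quotientRep m) (((∏ a : Fin 3, (((![x, z, y] : Fin 3 → (Fˣ →* ℂˣ))) a).comp (Matrix.GeneralLinearGroup.det.comp (Pi.evalMonoidHom (fun a : Fin 3 => GL {i : Fin 3 // (id : Fin 3 → Fin 3) i = a} F) a))) m : ℂˣ) : ℂ)) = 0 ∧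
    finrank ℂ ↥(⨅ m, Module.End.maxGenEigenspace (normalizedJacquetGL F (id : Fin 3 → Fin 3) N.quotientRep m) (((∏ a : Fin 3, (((![z, x, y] : Fin 3 → (Fˣ →* ℂˣ))) a).comp (Matrix.GeneralLinearGroup.det.comp (Pi.evalMonoidHom (fun a : Fin 3 => GL {i : Fin 3 // (id : Fin 3 → Fin 3) i = a} F) a))) m : ℂˣ) : ℂ)) = 0 ∧
    finrank ℂ ↥(⨅ m, Module.End.maxGenEigenspace (normalizedJacquetGL F (id : Fin 3 → Fin 3) N.quotientRep m) (((∏ a : Fin 3, (((![y, x, z] : Fin 3 → (Fˣ →* ℂˣ))) a).comp (Matrix.GeneralLinearGroup.det.comp (Pi.evalMonoidHom (fun a : Fin 3 => GL {i : Fin 3 // (id : Fin 3 → Fin 3) i = a} F) a))) m : ℂˣ) : ℂ)) = 1 ∧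
    finrank ℂ ↥(⨅ m, Module.End.maxGenEigenspace (normalizedJacquetGL F (id : Fin 3 → Fin 3) N.quotientRep m) (((∏ a : Fin 3, (((![y, z, x] : Fin 3 → (Fˣ →* ℂˣ))) a).comp (Matrix.GeneralLinearGroup.det.comp (Pi.evalMonoidHom (fun a : Fin 3 => GL {i : Fin 3 // (id : Fin 3 → Fin 3) i = a} F) a))) m : ℂˣ) : ℂ)) = 1 ∧
    finrank ℂ ↥(⨅ m, Module.End.maxGenEigenspace (normalizedJacquetGL F (id : Fin 3 → Fin 3) N.quotientRep m) (((∏ a : Fin 3, (((![z, y, x] : Fin 3 → (Fˣ →* ℂˣ))) a).comp (Matrix.GeneralLinearGroup.det.comp (Pi.evalMonoidHom (fun a : Fin 3 => GL {i : Fin 3 // (id : Fin 3 → Fin 3) i = a} F) a))) m : ℂˣ) : ℂ)) = 1 := by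
  -- frame
  have hθo : ∀ i, IsOpen ((((![x, y, z] : Fin 3 → (Fˣ →* ℂˣ)) i).ker : Subgroup Fˣ) : Set Fˣ) := fun i => by
    fin_cases i
    · exact hx
    · exact hy
    · exact hz
  have hIs : (parabolicIndGL F (id : Fin 3 → Fin 3) ((Representation.trivial ℂ (Π a : Fin 3, GL {i : Fin 3 // (id : Fin 3 → Fin 3) i = a} F) ℂ).twist (∏ a : Fin 3, (((![x, y, z] : Fin 3 → (Fˣ →* ℂˣ))) a).comp (Matrix.GeneralLinearGroup.det.comp (Pi.evalMonoidHom (fun a : Fin 3 => GL {i : Fin 3 // (id : Fin 3 → Fin 3) i = a} F) a))))).IsSmooth := Representation.isSmooth_smoothInd _ _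
  haveI hIfd : FiniteDimensional ℂ (restrictUnipotentGL F (id : Fin 3 → Fin 3) (parabolicIndGL F (id : Fin 3 → Fin 3) ((Representation.trivial ℂ (Π a : Fin 3, GL {i : Fin 3 // (id : Fin 3 → Fin 3) i = a} F) ℂ).twist (∏ a : Fin 3, (((![x, y, z] : Fin 3 → (Fˣ →* ℂˣ))) a).comp (Matrix.GeneralLinearGroup.det.comp (Pi.evalMonoidHom (fun a : Fin 3 => GL {i : Fin 3 // (id : Fin 3 → Fin 3) i = a} F) a)))))).Coinvariants :=
    (finrank_weightSpace_principalSeries_three_tch (![x, y, z] : Fin 3 → (Fˣ →* ℂˣ)) (isOpen_ker_tch _ hθo) (fun _ => 0)).1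
  have hRs : (N.toRepresentation).IsSmooth := hIs.toRepresentation N
  haveI hRfd : FiniteDimensional ℂ (restrictUnipotentGL F (id : Fin 3 → Fin 3) N.toRepresentation).Coinvariants := finiteDimensional_jacquet_subrepresentation _ monotone_id hIs N
  have hSs : (N.quotientRep).IsSmooth := hIs.quotientRep N
  haveI hSfd : FiniteDimensional ℂ (restrictUnipotentGL F (id : Fin 3 → Fin 3) N.quotientRep).Coinvariants := finiteDimensional_jacquet_quotientRep _ N
  -- the inclusion `N ↪ I θ` is non-zero
  have hΦ0 : Subrepresentation.subtypeIntertwiningMap N ≠ 0 := Subrepresentation.subtypeIntertwiningMap_ne_zero hN0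
  -- multiplicity one in `I θ` at the six weights (★ REG)
  have mI1 : finrank ℂ ↥(⨅ m, Module.End.maxGenEigenspace (normalizedJacquetGL F (id : Fin 3 → Fin 3) (parabolicIndGL F (id : Fin 3 → Fin 3) ((Representation.trivial ℂ (Π a : Fin 3, GL {i : Fin 3 // (id : Fin 3 → Fin 3) i = a} F) ℂ).twist (∏ a : Fin 3, (((![x, y, z] : Fin 3 → (Fˣ →* ℂˣ))) a).comp (Matrix.GeneralLinearGroup.det.comp (Pi.evalMonoidHom (fun a : Fin 3 => GL {i : Fin 3 // (id : Fin 3 → Fin 3) i = a} F) a))))) m) (((∏ a : Fin 3, (((![x, y, z] : Fin 3 → (Fˣ →* ℂˣ))) a).comp (Matrix.GeneralLinearGroup.det.comp (Pi.evalMonoidHom (fun a : Fin 3 => GL {i : Fin 3 // (id : Fin 3 → Fin 3) i = a} F) a))) m : ℂˣ) : ℂ)) = 1 :=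
    finrank_weightSpace_principalSeries_perm_eq_one _ hθo hinj 1 _ (fun i => by fin_cases i <;> rfl)
  have mI2 : finrank ℂ ↥(⨅ m, Module.End.maxGenEigenspace (normalizedJacquetGL F (id : Fin 3 → Fin 3) (parabolicIndGL F (id : Fin 3 → Fin 3) ((Representation.trivial ℂ (Π a : Fin 3, GL {i : Fin 3 // (id : Fin 3 → Fin 3) i = a} F) ℂ).twist (∏ a : Fin 3, (((![x, y, z] : Fin 3 → (Fˣ →* ℂˣ))) a).comp (Matrix.GeneralLinearGroup.det.comp (Pi.evalMonoidHom (fun a : Fin 3 => GL {i : Fin 3 // (id : Fin 3 → Fin 3) i = a} F) a))))) m) (((∏ a : Fin 3, (((![x, z, y] : Fin 3 → (Fˣ →* ℂˣ))) a).comp (Matrix.GeneralLinearGroup.det.comp (Pi.evalMonoidHom (fun a : Fin 3 => GL {i : Fin 3 // (id : Fin 3 → Fin 3) i = a} F) a))) m : ℂˣ) : ℂ)) = 1 :=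
    finrank_weightSpace_principalSeries_perm_eq_one _ hθo hinj (Equiv.swap (1 : Fin 3) 2) _ (fun i => by fin_cases i <;> rfl)
  have mI3 : finrank ℂ ↥(⨅ m, Module.End.maxGenEigenspace (normalizedJacquetGL F (id : Fin 3 → Fin 3) (parabolicIndGL F (id : Fin 3 → Fin 3) ((Representation.trivial ℂ (Π a : Fin 3, GL {i : Fin 3 // (id : Fin 3 → Fin 3) i = a} F) ℂ).twist (∏ a : Fin 3, (((![x, y, z] : Fin 3 → (Fˣ →* ℂˣ))) a).comp (Matrix.GeneralLinearGroup.det.comp (Pi.evalMonoidHom (fun a : Fin 3 => GL {i : Fin 3 // (id : Fin 3 → Fin 3) i = a} F) a))))) m) (((∏ a : Fin 3, (((![z, x, y] : Fin 3 → (Fˣ →* ℂˣ))) a).comp (Matrix.GeneralLinearGroup.det.comp (Pi.evalMonoidHom (fun a : Fin 3 => GL {i : Fin 3 // (id : Fin 3 → Fin 3) i = a} F) a))) m : ℂˣ) : ℂ)) = 1 :=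
    finrank_weightSpace_principalSeries_perm_eq_one _ hθo hinj (Equiv.swap (1 : Fin 3) 2 * Equiv.swap (0 : Fin 3) 1).symm _ (fun i => by fin_cases i <;> rfl)
  have mI4 : finrank ℂ ↥(⨅ m, Module.End.maxGenEigenspace (normalizedJacquetGL F (id : Fin 3 → Fin 3) (parabolicIndGL F (id : Fin 3 → Fin 3) ((Representation.trivial ℂ (Π a : Fin 3, GL {i : Fin 3 // (id : Fin 3 → Fin 3) i = a} F) ℂ).twist (∏ a : Fin 3, (((![x, y, z] : Fin 3 → (Fˣ →* ℂˣ))) a).comp (Matrix.GeneralLinearGroup.det.comp (Pi.evalMonoidHom (fun a : Fin 3 => GL {i : Fin 3 // (id : Fin 3 → Fin 3) i = a} F) a))))) m) (((∏ a : Fin 3, (((![y, x, z] : Fin 3 → (Fˣ →* ℂˣ))) a).comp (Matrix.GeneralLinearGroup.det.comp (Pi.evalMonoidHom (fun a : Fin 3 => GL {i : Fin 3 // (id : Fin 3 → Fin 3) i = a} F) a))) m : ℂˣ) : ℂ)) = 1 :=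
    finrank_weightSpace_principalSeries_perm_eq_one _ hθo hinj (Equiv.swap (0 : Fin 3) 1) _ (fun i => by fin_cases i <;> rfl)
  have mI5 : finrank ℂ ↥(⨅ m, Module.End.maxGenEigenspace (normalizedJacquetGL F (id : Fin 3 → Fin 3) (parabolicIndGL F (id : Fin 3 → Fin 3) ((Representation.trivial ℂ (Π a : Fin 3, GL {i : Fin 3 // (id : Fin 3 → Fin 3) i = a} F) ℂ).twist (∏ a : Fin 3, (((![x, y, z] : Fin 3 → (Fˣ →* ℂˣ))) a).comp (Matrix.GeneralLinearGroup.det.comp (Pi.evalMonoidHom (fun a : Fin 3 => GL {i : Fin 3 // (id : Fin 3 → Fin 3) i = a} F) a))))) m) (((∏ a : Fin 3, (((![y, z, x] : Fin 3 → (Fˣ →* ℂˣ))) a).comp (Matrix.GeneralLinearGroup.det.comp (Pi.evalMonoidHom (fun a : Fin 3 => GL {i : Fin 3 // (id : Fin 3 → Fin 3) i = a} F) a))) m : ℂˣ) : ℂ)) = 1 :=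
    finrank_weightSpace_principalSeries_perm_eq_one _ hθo hinj (Equiv.swap (0 : Fin 3) 1 * Equiv.swap (1 : Fin 3) 2).symm _ (fun i => by fin_cases i <;> rfl)
  have mI6 : finrank ℂ ↥(⨅ m, Module.End.maxGenEigenspace (normalizedJacquetGL F (id : Fin 3 → Fin 3) (parabolicIndGL F (id : Fin 3 → Fin 3) ((Representation.trivial ℂ (Π a : Fin 3, GL {i : Fin 3 // (id : Fin 3 → Fin 3) i = a} F) ℂ).twist (∏ a : Fin 3, (((![x, y, z] : Fin 3 → (Fˣ →* ℂˣ))) a).comp (Matrix.GeneralLinearGroup.det.comp (Pi.evalMonoidHom (fun a : Fin 3 => GL {i : Fin 3 // (id : Fin 3 → Fin 3) i = a} F) a))))) m) (((∏ a : Fin 3, (((![z, y, x] : Fin 3 → (Fˣ →* ℂˣ))) a).comp (Matrix.GeneralLinearGroup.det.comp (Pi.evalMonoidHom (fun a : Fin 3 => GL {i : Fin 3 // (id : Fin 3 → Fin 3) i = a} F) a))) m : ℂˣ) : ℂ)) = 1 :=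
    finrank_weightSpace_principalSeries_perm_eq_one _ hθo hinj (Equiv.swap (0 : Fin 3) 2) _ (fun i => by fin_cases i <;> rfl)
  -- additivity along `N ≤ I θ ↠ I θ ⁄ N` (★ ADD)
  have ad1 : finrank ℂ ↥(⨅ m, Module.End.maxGenEigenspace (normalizedJacquetGL F (id : Fin 3 → Fin 3) (parabolicIndGL F (id : Fin 3 → Fin 3) ((Representation.trivial ℂ (Π a : Fin 3, GL {i : Fin 3 // (id : Fin 3 → Fin 3) i = a} F) ℂ).twist (∏ a : Fin 3, (((![x, y, z] : Fin 3 → (Fˣ →* ℂˣ))) a).comp (Matrix.GeneralLinearGroup.det.comp (Pi.evalMonoidHom (fun a : Fin 3 => GL {i : Fin 3 // (id : Fin 3 → Fin 3) i = a} F) a))))) m) (((∏ a : Fin 3, (((![x, y, z] : Fin 3 → (Fˣ →* ℂˣ))) a).comp (Matrix.GeneralLinearGroup.det.comp (Pi.evalMonoidHom (fun a : Fin 3 => GL {i : Fin 3 // (id : Fin 3 → Fin 3) i = a} F) a))) m : ℂˣ) : ℂ)) = finrank ℂ ↥(⨅ m, Module.End.maxGenEigenspace (normalizedJacquetGL F (id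 : Fin 3 → Fin 3) N.toRepresentation m) (((∏ a : Fin 3, (((![x, y, z] : Fin 3 → (Fˣ →* ℂˣ))) a).comp (Matrix.GeneralLinearGroup.det.comp (Pi.evalMonoidHom (fun a : Fin 3 => GL {i : Fin 3 // (id : Fin 3 → Fin 3) i = a} F) a))) m : ℂˣ) : ℂ)) + finrank ℂ ↥(⨅ m, Module.End.maxGenEigenspace (normalizedJacquetGL F (id : Fin 3 → Fin 3) N.quotientRep m) (((∏ a : Fin 3, (((![x, y, z] : Fin 3 → (Fˣ →* ℂˣ))) a).comp (Matrix.GeneralLinearGroup.det.comp (Pi.evalMonoidHom (fun a : Fin 3 => GL {i : Fin 3 // (id : Fin 3 → Fin 3) i = a} F) a))) m : ℂˣ) : ℂ)) := finrank_weightSpace_eq_add_subrepresentation _ hIs N _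
  have ad2 : finrank ℂ ↥(⨅ m, Module.End.maxGenEigenspace (normalizedJacquetGL F (id : Fin 3 → Fin 3) (parabolicIndGL F (id : Fin 3 → Fin 3) ((Representation.trivial ℂ (Π a : Fin 3, GL {i : Fin 3 // (id : Fin 3 → Fin 3) i = a} F) ℂ).twist (∏ a : Fin 3, (((![x, y, z] : Fin 3 → (Fˣ →* ℂˣ))) a).comp (Matrix.GeneralLinearGroup.det.comp (Pi.evalMonoidHom (fun a : Fin 3 => GL {i : Fin 3 // (id : Fin 3 → Fin 3) i = a} F) a))))) m) (((∏ a : Fin 3, (((![x, z, y] : Fin 3 → (Fˣ →* ℂˣ))) a).comp (Matrix.GeneralLinearGroup.det.comp (Pi.evalMonoidHom (fun a : Fin 3 => GL {i : Fin 3 // (id : Fin 3 → Fin 3) i = a} F) a))) m : ℂˣ) : ℂ)) = finrank ℂ ↥(⨅ m, Module.End.maxGenEigenspace (normalizedJacquetGL F (id : Fin 3 → Fin 3) N.toRepresentation m) (((∏ a : Fin 3, (((![x, z, y] : Fin 3 → (Fˣ →* ℂˣ))) a).comp (Matrix.GeneralLinearGroup.det.comp (Pi.evalMonoidHom (fun a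 : Fin 3 => GL {i : Fin 3 // (id : Fin 3 → Fin 3) i = a} F) a))) m : ℂˣ) : ℂ)) + finrank ℂ ↥(⨅ m, Module.End.maxGenEigenspace (normalizedJacquetGL F (id : Fin 3 → Fin 3) N.quotientRep m) (((∏ a : Fin 3, (((![x, z, y] : Fin 3 → (Fˣ →* ℂˣ))) a).comp (Matrix.GeneralLinearGroup.det.comp (Pi.evalMonoidHom (fun a : Fin 3 => GL {i : Fin 3 // (id : Fin 3 → Fin 3) i = a} F) a))) m : ℂˣ) : ℂ)) := finrank_weightSpace_eq_add_subrepresentation _ hIs N _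
  have ad3 : finrank ℂ ↥(⨅ m, Module.End.maxGenEigenspace (normalizedJacquetGL F (id : Fin 3 → Fin 3) (parabolicIndGL F (id : Fin 3 → Fin 3) ((Representation.trivial ℂ (Π a : Fin 3, GL {i : Fin 3 // (id : Fin 3 → Fin 3) i = a} F) ℂ).twist (∏ a : Fin 3, (((![x, y, z] : Fin 3 → (Fˣ →* ℂˣ))) a).comp (Matrix.GeneralLinearGroup.det.comp (Pi.evalMonoidHom (fun a : Fin 3 => GL {i : Fin 3 // (id : Fin 3 → Fin 3) i = a} F) a))))) m) (((∏ a : Fin 3, (((![z, x, y] : Fin 3 → (Fˣ →* ℂˣ))) a).comp (Matrix.GeneralLinearGroup.det.comp (Pi.evalMonoidHom (fun a : Fin 3 => GL {i : Fin 3 // (id : Fin 3 → Fin 3) i = a} F) a))) m : ℂˣ) : ℂ)) = finrank ℂ ↥(⨅ m, Module.End.maxGenEigenspace (normalizedJacquetGL F (id : Fin 3 → Fin 3) N.toRepresentation m) (((∏ a : Fin 3, (((![z, x, y] : Fin 3 → (Fˣ →* ℂˣ))) a).comp (Matrix.GeneralLinearGroup.det.comp (Pi.evalMonoidHom (fun a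 : Fin 3 => GL {i : Fin 3 // (id : Fin 3 → Fin 3) i = a} F) a))) m : ℂˣ) : ℂ)) + finrank ℂ ↥(⨅ m, Module.End.maxGenEigenspace (normalizedJacquetGL F (id : Fin 3 → Fin 3) N.quotientRep m) (((∏ a : Fin 3, (((![z, x, y] : Fin 3 → (Fˣ →* ℂˣ))) a).comp (Matrix.GeneralLinearGroup.det.comp (Pi.evalMonoidHom (fun a : Fin 3 => GL {i : Fin 3 // (id : Fin 3 → Fin 3) i = a} F) a))) m : ℂˣ) : ℂ)) := finrank_weightSpace_eq_add_subrepresentation _ hIs N _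
  have ad4 : finrank ℂ ↥(⨅ m, Module.End.maxGenEigenspace (normalizedJacquetGL F (id : Fin 3 → Fin 3) (parabolicIndGL F (id : Fin 3 → Fin 3) ((Representation.trivial ℂ (Π a : Fin 3, GL {i : Fin 3 // (id : Fin 3 → Fin 3) i = a} F) ℂ).twist (∏ a : Fin 3, (((![x, y, z] : Fin 3 → (Fˣ →* ℂˣ))) a).comp (Matrix.GeneralLinearGroup.det.comp (Pi.evalMonoidHom (fun a : Fin 3 => GL {i : Fin 3 // (id : Fin 3 → Fin 3) i = a} F) a))))) m) (((∏ a : Fin 3, (((![y, x, z] : Fin 3 → (Fˣ →* ℂˣ))) a).comp (Matrix.GeneralLinearGroup.det.comp (Pi.evalMonoidHom (fun a : Fin 3 => GL {i : Fin 3 // (id : Fin 3 → Fin 3) i = a} F) a))) m : ℂˣ) : ℂ)) = finrank ℂ ↥(⨅ m, Module.End.maxGenEigenspace (normalizedJacquetGL F (id : Fin 3 → Fin 3) N.toRepresentation m) (((∏ a : Fin 3, (((![y, x, z] : Fin 3 → (Fˣ →* ℂˣ))) a).comp (Matrix.GeneralLinearGroup.det.comp (Pi.evalMonoidHom (fun a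 : Fin 3 => GL {i : Fin 3 // (id : Fin 3 → Fin 3) i = a} F) a))) m : ℂˣ) : ℂ)) + finrank ℂ ↥(⨅ m, Module.End.maxGenEigenspace (normalizedJacquetGL F (id : Fin 3 → Fin 3) N.quotientRep m) (((∏ a : Fin 3, (((![y, x, z] : Fin 3 → (Fˣ →* ℂˣ))) a).comp (Matrix.GeneralLinearGroup.det.comp (Pi.evalMonoidHom (fun a : Fin 3 => GL {i : Fin 3 // (id : Fin 3 → Fin 3) i = a} F) a))) m : ℂˣ) : ℂ)) := finrank_weightSpace_eq_add_subrepresentation _ hIs N _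
  have ad5 : finrank ℂ ↥(⨅ m, Module.End.maxGenEigenspace (normalizedJacquetGL F (id : Fin 3 → Fin 3) (parabolicIndGL F (id : Fin 3 → Fin 3) ((Representation.trivial ℂ (Π a : Fin 3, GL {i : Fin 3 // (id : Fin 3 → Fin 3) i = a} F) ℂ).twist (∏ a : Fin 3, (((![x, y, z] : Fin 3 → (Fˣ →* ℂˣ))) a).comp (Matrix.GeneralLinearGroup.det.comp (Pi.evalMonoidHom (fun a : Fin 3 => GL {i : Fin 3 // (id : Fin 3 → Fin 3) i = a} F) a))))) m) (((∏ a : Fin 3, (((![y, z, x] : Fin 3 → (Fˣ →* ℂˣ))) a).comp (Matrix.GeneralLinearGroup.det.comp (Pi.evalMonoidHom (fun a : Fin 3 => GL {i : Fin 3 // (id : Fin 3 → Fin 3) i = a} F) a))) m : ℂˣ) : ℂ)) = finrank ℂ ↥(⨅ m, Module.End.maxGenEigenspace (normalizedJacquetGL F (id : Fin 3 → Fin 3) N.toRepresentation m) (((∏ a : Fin 3, (((![y, z, x] : Fin 3 → (Fˣ →* ℂˣ))) a).comp (Matrix.GeneralLinearGroup.det.comp (Pi.evalMonoidHom (fun a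 : Fin 3 => GL {i : Fin 3 // (id : Fin 3 → Fin 3) i = a} F) a))) m : ℂˣ) : ℂ)) + finrank ℂ ↥(⨅ m, Module.End.maxGenEigenspace (normalizedJacquetGL F (id : Fin 3 → Fin 3) N.quotientRep m) (((∏ a : Fin 3, (((![y, z, x] : Fin 3 → (Fˣ →* ℂˣ))) a).comp (Matrix.GeneralLinearGroup.det.comp (Pi.evalMonoidHom (fun a : Fin 3 => GL {i : Fin 3 // (id : Fin 3 → Fin 3) i = a} F) a))) m : ℂˣ) : ℂ)) := finrank_weightSpace_eq_add_subrepresentation _ hIs N _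
  have ad6 : finrank ℂ ↥(⨅ m, Module.End.maxGenEigenspace (normalizedJacquetGL F (id : Fin 3 → Fin 3) (parabolicIndGL F (id : Fin 3 → Fin 3) ((Representation.trivial ℂ (Π a : Fin 3, GL {i : Fin 3 // (id : Fin 3 → Fin 3) i = a} F) ℂ).twist (∏ a : Fin 3, (((![x, y, z] : Fin 3 → (Fˣ →* ℂˣ))) a).comp (Matrix.GeneralLinearGroup.det.comp (Pi.evalMonoidHom (fun a : Fin 3 => GL {i : Fin 3 // (id : Fin 3 → Fin 3) i = a} F) a))))) m) (((∏ a : Fin 3, (((![z, y, x] : Fin 3 → (Fˣ →* ℂˣ))) a).comp (Matrix.GeneralLinearGroup.det.comp (Pi.evalMonoidHom (fun a : Fin 3 => GL {i : Fin 3 // (id : Fin 3 → Fin 3) i = a} F) a))) m : ℂˣ) : ℂ)) = finrank ℂ ↥(⨅ m, Module.End.maxGenEigenspace (normalizedJacquetGL F (id : Fin 3 → Fin 3) N.toRepresentation m) (((∏ a : Fin 3, (((![z, y, x] : Fin 3 → (Fˣ →* ℂˣ))) a).comp (Matrix.GeneralLinearGroup.det.comp (Pi.evalMonoidHom (fun a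 : Fin 3 => GL {i : Fin 3 // (id : Fin 3 → Fin 3) i = a} F) a))) m : ℂˣ) : ℂ)) + finrank ℂ ↥(⨅ m, Module.End.maxGenEigenspace (normalizedJacquetGL F (id : Fin 3 → Fin 3) N.quotientRep m) (((∏ a : Fin 3, (((![z, y, x] : Fin 3 → (Fˣ →* ℂˣ))) a).comp (Matrix.GeneralLinearGroup.det.comp (Pi.evalMonoidHom (fun a : Fin 3 => GL {i : Fin 3 // (id : Fin 3 → Fin 3) i = a} F) a))) m : ℂˣ) : ℂ)) := finrank_weightSpace_eq_add_subrepresentation _ hIs N _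
  -- `mult N A₁ ≠ 0` (★ EMB converse on the inclusion)
  have hRA1 : finrank ℂ ↥(⨅ m, Module.End.maxGenEigenspace (normalizedJacquetGL F (id : Fin 3 → Fin 3) N.toRepresentation m) (((∏ a : Fin 3, (((![x, y, z] : Fin 3 → (Fˣ →* ℂˣ))) a).comp (Matrix.GeneralLinearGroup.det.comp (Pi.evalMonoidHom (fun a : Fin 3 => GL {i : Fin 3 // (id : Fin 3 → Fin 3) i = a} F) a))) m : ℂˣ) : ℂ)) ≠ 0 := finrank_weightSpace_ne_zero_of_intertwiningMap_ne_zero _ hRs _ _ hΦ0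
  -- the H0 swaps on `N` and on `I θ ⁄ N` inside each class
  have rA12 : finrank ℂ ↥(⨅ m, Module.End.maxGenEigenspace (normalizedJacquetGL F (id : Fin 3 → Fin 3) N.toRepresentation m) (((∏ a : Fin 3, (((![x, y, z] : Fin 3 → (Fˣ →* ℂˣ))) a).comp (Matrix.GeneralLinearGroup.det.comp (Pi.evalMonoidHom (fun a : Fin 3 => GL {i : Fin 3 // (id : Fin 3 → Fin 3) i = a} F) a))) m : ℂˣ) : ℂ)) = finrank ℂ ↥(⨅ m, Module.End.maxGenEigenspace (normalizedJacquetGL F (id : Fin 3 → Fin 3) N.toRepresentation m) (((∏ a : Fin 3, (((![x, z, y] : Fin 3 → (Fˣ →* ℂˣ))) a).comp (Matrix.GeneralLinearGroup.det.comp (Pi.evalMonoidHom (fun a : Fin 3 => GL {i : Fin 3 // (id : Fin 3 → Fin 3) i = a} F) a))) m : ℂˣ) : ℂ)) := finrank_weightSpace_swap₁₂ _ hRs _ _ _ hy hz u₁ u₂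
  have rA23 : finrank ℂ ↥(⨅ m, Module.End.maxGenEigenspace (normalizedJacquetGL F (id : Fin 3 → Fin 3) N.toRepresentation m) (((∏ a : Fin 3, (((![x, z, y] : Fin 3 → (Fˣ →* ℂˣ))) a).comp (Matrix.GeneralLinearGroup.det.comp (Pi.evalMonoidHom (fun a : Fin 3 => GL {i : Fin 3 // (id : Fin 3 → Fin 3) i = a} F) a))) m : ℂˣ) : ℂ)) = finrank ℂ ↥(⨅ m, Module.End.maxGenEigenspace (normalizedJacquetGL F (id : Fin 3 → Fin 3) N.toRepresentation m) (((∏ a : Fin 3, (((![z, x, y] : Fin 3 → (Fˣ →* ℂˣ))) a).comp (Matrix.GeneralLinearGroup.det.comp (Pi.evalMonoidHom (fun a : Fin 3 => GL {i : Fin 3 // (id : Fin 3 → Fin 3) i = a} F) a))) m : ℂˣ) : ℂ)) := finrank_weightSpace_swap₀₁ _ hRs _ _ _ hx hz u₃ u₄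
  have sB12 : finrank ℂ ↥(⨅ m, Module.End.maxGenEigenspace (normalizedJacquetGL F (id : Fin 3 → Fin 3) N.quotientRep m) (((∏ a : Fin 3, (((![y, x, z] : Fin 3 → (Fˣ →* ℂˣ))) a).comp (Matrix.GeneralLinearGroup.det.comp (Pi.evalMonoidHom (fun a : Fin 3 => GL {i : Fin 3 // (id : Fin 3 → Fin 3) i = a} F) a))) m : ℂˣ) : ℂ)) = finrank ℂ ↥(⨅ m, Module.End.maxGenEigenspace (normalizedJacquetGL F (id : Fin 3 → Fin 3) N.quotientRep m) (((∏ a : Fin 3, (((![y, z, x] : Fin 3 → (Fˣ →* ℂˣ))) a).comp (Matrix.GeneralLinearGroup.det.comp (Pi.evalMonoidHom (fun a : Fin 3 => GL {i : Fin 3 // (id : Fin 3 → Fin 3) i = a} F) a))) m : ℂˣ) : ℂ)) := finrank_weightSpace_swap₁₂ _ hSs _ _ _ hx hz u₃ u₄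
  have sB23 : finrank ℂ ↥(⨅ m, Module.End.maxGenEigenspace (normalizedJacquetGL F (id : Fin 3 → Fin 3) N.quotientRep m) (((∏ a : Fin 3, (((![y, z, x] : Fin 3 → (Fˣ →* ℂˣ))) a).comp (Matrix.GeneralLinearGroup.det.comp (Pi.evalMonoidHom (fun a : Fin 3 => GL {i : Fin 3 // (id : Fin 3 → Fin 3) i = a} F) a))) m : ℂˣ) : ℂ)) = finrank ℂ ↥(⨅ m, Module.End.maxGenEigenspace (normalizedJacquetGL F (id : Fin 3 → Fin 3) N.quotientRep m) (((∏ a : Fin 3, (((![z, y, x] : Fin 3 → (Fˣ →* ℂˣ))) a).comp (Matrix.GeneralLinearGroup.det.comp (Pi.evalMonoidHom (fun a : Fin 3 => GL {i : Fin 3 // (id : Fin 3 → Fin 3) i = a} F) a))) m : ℂˣ) : ℂ)) := finrank_weightSpace_swap₀₁ _ hSs _ _ _ hy hz u₁ u₂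
  -- class_A: `mult N = 1`, `mult (I θ ⁄ N) = 0`
  have hAS1 := nat_eq_of_add_eq_one_left (ad1.symm.trans mI1) hRA1
  have eR1 := hAS1.1
  have eS1 := hAS1.2
  have hAS2 := nat_eq_of_add_eq_one_left (ad2.symm.trans mI2) (fun h0 => hRA1 (rA12.trans h0))
  have eR2 := hAS2.1
  have eS2 := hAS2.2
  have hAS3 := nat_eq_of_add_eq_one_left (ad3.symm.trans mI3) (fun h0 => hRA1 (rA12.trans (rA23.trans h0)))
  have eR3 := hAS3.1
  have eS3 := hAS3.2
  -- `I θ ⁄ N ≠ 0` has a weight; it lies in class_B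
  have hSB : finrank ℂ ↥(⨅ m, Module.End.maxGenEigenspace (normalizedJacquetGL F (id : Fin 3 → Fin 3) N.quotientRep m) (((∏ a : Fin 3, (((![y, x, z] : Fin 3 → (Fˣ →* ℂˣ))) a).comp (Matrix.GeneralLinearGroup.det.comp (Pi.evalMonoidHom (fun a : Fin 3 => GL {i : Fin 3 // (id : Fin 3 → Fin 3) i = a} F) a))) m : ℂˣ) : ℂ)) ≠ 0 := by
    have hex := exists_finrank_weightSpace_quotientRep_principalSeries_ne_zero (![x, y, z] : Fin 3 → (Fˣ →* ℂˣ)) (isOpen_ker_tch _ hθo) h3cell N hN1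
    obtain ⟨χ, hχ⟩ := hex
    have hadd := finrank_weightSpace_eq_add_subrepresentation _ hIs N χ
    have hIχ : finrank ℂ ↥(⨅ m, Module.End.maxGenEigenspace (normalizedJacquetGL F (id : Fin 3 → Fin 3) (parabolicIndGL F (id : Fin 3 → Fin 3) ((Representation.trivial ℂ (Π a : Fin 3, GL {i : Fin 3 // (id : Fin 3 → Fin 3) i = a} F) ℂ).twist (∏ a : Fin 3, (((![x, y, z] : Fin 3 → (Fˣ →* ℂˣ))) a).comp (Matrix.GeneralLinearGroup.det.comp (Pi.evalMonoidHom (fun a : Fin 3 => GL {i : Fin 3 // (id : Fin 3 → Fin 3) i = a} F) a))))) m) (χ m)) ≠ 0 :=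
      fun h0 => hχ (Nat.eq_zero_of_add_eq_zero_left (hadd.symm.trans h0))
    have hsix := weight_six_cases x y z hx hy hz χ hIχ
    rcases hsix with hv | hv | hv | hv | hv | hv <;> rw [hv] at hχ
    · exact absurd eS1 hχ
    · exact absurd eS2 hχ
    · exact hχ
    · exact fun h0 => hχ (sB12.symm.trans h0)
    · exact absurd eS3 hχ
    · exact fun h0 => hχ (sB23.symm.trans (sB12.symm.trans h0))
  -- class_B: `mult N = 0`, `mult (I θ ⁄ N) = 1`
  have hAS4 := nat_eq_of_add_eq_one_right (ad4.symm.trans mI4) hSB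
  have eR4 := hAS4.1
  have eS4 := hAS4.2
  have hAS5 := nat_eq_of_add_eq_one_right (ad5.symm.trans mI5) (fun h0 => hSB (sB12.trans h0))
  have eR5 := hAS5.1
  have eS5 := hAS5.2
  have hAS6 := nat_eq_of_add_eq_one_right (ad6.symm.trans mI6) (fun h0 => hSB (sB12.trans (sB23.trans h0)))
  have eR6 := hAS6.1
  have eS6 := hAS6.2
  exact ⟨eR1, eR2, eR3, eR4, eR5, eR6, eS1, eS2, eS3, eS4, eS5, eS6⟩

end Summit.HodgeConjecture.HodgeConjecture.Cruxes.H413.K2E3GL3OneLinkGeneric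

end
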